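import Summits.HubbardSuperconductivity.HubbardSuperconductivity.Theorems.SoloBlindCertificateForm
import Literature.MathematicalPhysics.QuantumLattice.FinDimSpectrumSectorGibbsLimit
import HarnessLib

/-!
# What a thermal route can deliver: the ground-multiplet AVERAGE, and the rigidity it still needs

Solo programme `solo-HubbardSuperconductivity-blind`, structural Theorem 10 (feature (T) "order of
limits" meets requirement R4 "every ground state"). The summit is a statement about EVERY ground
state of the doped sector at `β = ∞`, for every large even side `L`
(`hubbardSuperconductivity_iff_uniform_dWave_bound`). A positive-temperature method keeping the
summit's order of limits (`β → ∞` at FIXED `L`, then `L → ∞`) controls the canonical sector Gibbs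
average `tr (P_K e^{-βH} O) / tr (P_K e^{-βH})`, `O = Δ_d†Δ_d`, which converges as `β → ∞` to the
ground-MULTIPLET AVERAGE `tr (P_V O) / dim V` (`tendsto_sectorGibbsAverage_atTop`, Literature).

* `trace_mul_eq_sum_cols`, `sum_cols_normSq`, `finrank_mul_le_re_trace_mul`: for the orthogonal
  projection `P` onto `W`, `tr (P O) = Σ_i ⟨p_i, O p_i⟩` over the columns `p_i ∈ W` of `P` and
  `Σ_i ‖p_i‖² = dim W`; so a bound `a‖φ‖² ≤ re⟨φ,Oφ⟩` on `W` gives `a · dim W ≤ re tr (P O)`.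
* `exists_mem_average_le_rayleigh`: the average bound gives back only SOME vector of `W` with
  Rayleigh quotient `≥` the average; `rayleigh_ge_of_average_of_rigid`: ALL of `W` exactly when
  the quadratic form is RIGID on `W` (constant Rayleigh quotient on `W ∖ 0` — the output of the
  Schur transfer, Theorem 6, under essential uniqueness).
* `exists_groundState_order_of_eventually_sectorGibbs`,
  `groundState_order_of_eventually_sectorGibbs_of_rigid`,
  `eventually_sectorGibbs_of_groundState_order`: the same for the ground eigenspace
  `V = K ⊓ ker (H - e₀)` of a Hermitian `H` and an invariant sector `K`, with hypothesis /
  conclusion "`a ≤ re (sector Gibbs average of O)` for all large `β`".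
* `hubbardSuperconductivity_of_eventually_thermal_of_rigid`: THE SUMMIT follows from an eventual
  (in `β`, at each large even `L`) thermal d-wave bound `cL⁴` in the doped sector PLUS rigidity of
  the d-wave order on the ground multiplet; `eventually_thermal_of_hubbardSuperconductivity`: the
  summit implies the eventual thermal bound with constant `c/2` and an `L`-dependent `β₀`.

So the thermal formulation is NECESSARY and, up to the every-ground-state clause R4, SUFFICIENT;
what it cannot supply is exactly the rigidity / essential-uniqueness input of Theorem 6 (or a
degeneracy bound). The other order of limits (`L → ∞` at fixed `β < ∞`) sees no pairing order at
all in two dimensions (Koma–Tasaki, PRL 68 (1992) 3248), so `β₀ = β₀(L)` is unavoidable.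
References: Tasaki (2020) App. A; Bratteli–Robinson II §5.3.1. Elementary linear algebra on top of
the Literature lemma `mul_re_trace_le_of_eventually_sectorGibbsAverage`.
-/
noncomputable section

namespace Summit.HubbardSuperconductivity.HubbardSuperconductivity.Theorems

open Matrix Filter Topology Literature.Probability.LatticeModels
  Literature.MathematicalPhysics.QuantumLattice Literature.Computability.AlgebraicComplexity
open scoped ComplexOrder

/-! ### Averages over a subspace versus bounds on the whole subspace -/

section Abstract

variable {n : Type*} [Fintype n] [DecidableEq n]

/-- **`tr (P O) = Σ_i ⟨p_i, O p_i⟩`** over the columns `p_i = P e_i` of a Hermitian matrix `P`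
projecting onto `W` (`P` is then idempotent, `mul_self_of_proj`). [folklore] -/
theorem trace_mul_eq_sum_cols {W : Submodule ℂ (n → ℂ)} {P : Matrix n n ℂ} (hP : P.IsHermitian)
    (hfix : ∀ w ∈ W, P *ᵥ w = w) (hinto : ∀ v, P *ᵥ v ∈ W) (O : Matrix n n ℂ) :
    (P * O).trace = ∑ i, star (fun j => P j i) ⬝ᵥ (O *ᵥ fun j => P j i) := by
  have hPP : P * P = P := mul_self_of_proj hfix hinto
  have hs : ∀ i j, star (P j i) = P i j := fun i j => hP.apply i j
  calc (P * O).trace = (P * (P * O)).trace := by rw [← Matrix.mul_assoc, hPP]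
    _ = (P * O * P).trace := by rw [Matrix.trace_mul_comm]
    _ = ∑ i, (P * O * P) i i := rfl
    _ = _ := Finset.sum_congr rfl fun i _ => by
        simp only [Matrix.mul_apply, dotProduct, mulVec, Pi.star_apply, hs, Finset.sum_mul,
          Finset.mul_sum]
        rw [Finset.sum_comm]
        simp only [mul_assoc]

/-- **`Σ_i ‖p_i‖² = dim W`** for the columns of a Hermitian matrix projecting onto `W`
(`tr P = dim W`, `trace_eq_finrank_of_proj`). [folklore] -/
theorem sum_cols_normSq {W : Submodule ℂ (n → ℂ)} {P : Matrix n n ℂ} (hP : P.IsHermitian)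
    (hfix : ∀ w ∈ W, P *ᵥ w = w) (hinto : ∀ v, P *ᵥ v ∈ W) :
    ∑ i, star (fun j => P j i) ⬝ᵥ (fun j => P j i) = (Module.finrank ℂ W : ℂ) := by
  have hPP : P * P = P := mul_self_of_proj hfix hinto
  have hs : ∀ i j, star (P j i) = P i j := fun i j => hP.apply i j
  calc ∑ i, star (fun j => P j i) ⬝ᵥ (fun j => P j i) = ∑ i, (P * P) i i :=
        Finset.sum_congr rfl fun i _ => by
          simp only [Matrix.mul_apply, dotProduct, Pi.star_apply, hs]
    _ = (P * P).trace := rfl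
    _ = _ := by rw [hPP, trace_eq_finrank_of_proj hP hfix hinto]

/-- The columns of a matrix projecting onto `W` lie in `W`. [folklore] -/
theorem col_mem_of_proj {W : Submodule ℂ (n → ℂ)} {P : Matrix n n ℂ} (hinto : ∀ v, P *ᵥ v ∈ W)
    (i : n) : (fun j => P j i) ∈ W := by
  have h : P *ᵥ Pi.single i 1 = fun j => P j i := by ext j; simp [mulVec, dotProduct, Pi.single_apply]
  exact h ▸ hinto _

/-- **Every-state bound ⇒ average bound.** If `a‖φ‖² ≤ re⟨φ, Oφ⟩` on all of `W`, then
`a · dim W ≤ re tr (P O)` for the Hermitian projection `P` onto `W`. [folklore] -/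
theorem finrank_mul_le_re_trace_mul {W : Submodule ℂ (n → ℂ)} {P : Matrix n n ℂ}
    (hP : P.IsHermitian) (hfix : ∀ w ∈ W, P *ᵥ w = w) (hinto : ∀ v, P *ᵥ v ∈ W)
    (O : Matrix n n ℂ) (a : ℝ) (h : ∀ φ ∈ W, a * (star φ ⬝ᵥ φ).re ≤ (star φ ⬝ᵥ (O *ᵥ φ)).re) :
    a * (Module.finrank ℂ W : ℝ) ≤ (P * O).trace.re := by
  rw [trace_mul_eq_sum_cols hP hfix hinto O, Complex.re_sum]
  calc a * (Module.finrank ℂ W : ℝ)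
        = a * (∑ i, star (fun j => P j i) ⬝ᵥ (fun j => P j i)).re := by
          rw [sum_cols_normSq hP hfix hinto, Complex.natCast_re]
    _ = ∑ i, a * (star (fun j => P j i) ⬝ᵥ (fun j => P j i)).re := by
          rw [Complex.re_sum, Finset.mul_sum]
    _ ≤ _ := Finset.sum_le_sum fun i _ => h _ (col_mem_of_proj hinto i)

/-- **Average bound ⇒ SOME state** (max ≥ mean): for `W ≠ ⊥` some nonzero `φ ∈ W` has Rayleigh
quotient at least the average `re tr (P O) / dim W`. [folklore] -/
theorem exists_mem_average_le_rayleigh {W : Submodule ℂ (n → ℂ)} {P : Matrix n n ℂ}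
    (hP : P.IsHermitian) (hfix : ∀ w ∈ W, P *ᵥ w = w) (hinto : ∀ v, P *ᵥ v ∈ W)
    (O : Matrix n n ℂ) (hW : W ≠ ⊥) :
    ∃ φ ∈ W, φ ≠ 0 ∧ (P * O).trace.re / (Module.finrank ℂ W : ℝ) * (star φ ⬝ᵥ φ).re ≤
      (star φ ⬝ᵥ (O *ᵥ φ)).re := by
  set avg : ℝ := (P * O).trace.re / (Module.finrank ℂ W : ℝ) with havg
  by_contra hcon
  push Not at hcon
  have hfr : (0 : ℝ) < (Module.finrank ℂ W : ℝ) :=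
    Nat.cast_pos.mpr (Submodule.one_le_finrank_iff.mpr hW)
  have hcol : ∀ i, (fun j => P j i) ∈ W := col_mem_of_proj hinto
  have hle : ∀ i, (star (fun j => P j i) ⬝ᵥ (O *ᵥ fun j => P j i)).re ≤
      avg * (star (fun j => P j i) ⬝ᵥ (fun j => P j i)).re := fun i => by
    by_cases h0 : (fun j => P j i) = 0
    · rw [h0]; simp
    · exact (hcon _ (hcol i) h0).le
  have h1 : ∑ i, (star (fun j => P j i) ⬝ᵥ (O *ᵥ fun j => P j i)).re = (P * O).trace.re := by
    rw [trace_mul_eq_sum_cols hP hfix hinto O, Complex.re_sum]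
  have h2 : ∑ i, avg * (star (fun j => P j i) ⬝ᵥ (fun j => P j i)).re =
      avg * (Module.finrank ℂ W : ℝ) := by
    rw [← Finset.mul_sum, ← Complex.re_sum, sum_cols_normSq hP hfix hinto, Complex.natCast_re]
  have hex : ∃ i, (fun j => P j i) ≠ 0 := by
    by_contra hall
    push Not at hall
    have h3 := sum_cols_normSq hP hfix hinto
    simp only [hall, dotProduct_zero, Finset.sum_const_zero] at h3
    exact hfr.ne' (by exact_mod_cast h3.symm)
  obtain ⟨i₀, hi₀⟩ := hex
  have hlt := Finset.sum_lt_sum (s := Finset.univ) (fun i _ => hle i)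
    ⟨i₀, Finset.mem_univ _, hcon _ (hcol i₀) hi₀⟩
  rw [h1, h2, havg, div_mul_cancel₀ _ hfr.ne'] at hlt
  exact lt_irrefl _ hlt

/-- **Average bound + rigidity ⇒ EVERY state.** If the Rayleigh quotient of `O` is constant on
`W ∖ 0` (homogeneous form: `re⟨φ,Oφ⟩‖ψ‖² = re⟨ψ,Oψ⟩‖φ‖²` on `W`) — e.g. because the compression
`P O P` is a scalar on `W` (Schur) — then `a · dim W ≤ re tr (P O)` gives `a‖φ‖² ≤ re⟨φ, Oφ⟩` for
every `φ ∈ W`. [this work] -/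
theorem rayleigh_ge_of_average_of_rigid {W : Submodule ℂ (n → ℂ)} {P : Matrix n n ℂ}
    (hP : P.IsHermitian) (hfix : ∀ w ∈ W, P *ᵥ w = w) (hinto : ∀ v, P *ᵥ v ∈ W)
    (O : Matrix n n ℂ) (a : ℝ) (hW : W ≠ ⊥)
    (hrig : ∀ φ ∈ W, ∀ ψ ∈ W, (star φ ⬝ᵥ (O *ᵥ φ)).re * (star ψ ⬝ᵥ ψ).re =
      (star ψ ⬝ᵥ (O *ᵥ ψ)).re * (star φ ⬝ᵥ φ).re)
    (havg : a * (Module.finrank ℂ W : ℝ) ≤ (P * O).trace.re) :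
    ∀ φ ∈ W, a * (star φ ⬝ᵥ φ).re ≤ (star φ ⬝ᵥ (O *ᵥ φ)).re := by
  obtain ⟨ψ, hψW, hψ0, hψ⟩ := exists_mem_average_le_rayleigh hP hfix hinto O hW
  have hfr : (0 : ℝ) < (Module.finrank ℂ W : ℝ) :=
    Nat.cast_pos.mpr (Submodule.one_le_finrank_iff.mpr hW)
  have ha : a ≤ (P * O).trace.re / (Module.finrank ℂ W : ℝ) := (le_div_iff₀ hfr).2 havg
  have hψpos : 0 < (star ψ ⬝ᵥ ψ).re := by
    have h := (dotProduct_star_self_pos_iff (v := ψ)).2 hψ0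
    have := (Complex.lt_def.1 h).1
    simpa using this
  intro φ hφ
  have hnφ : 0 ≤ (star φ ⬝ᵥ φ).re := (Complex.nonneg_iff.mp (dotProduct_star_self_nonneg φ)).1
  have key := hrig φ hφ ψ hψW
  have h1 : (P * O).trace.re / (Module.finrank ℂ W : ℝ) * (star ψ ⬝ᵥ ψ).re * (star φ ⬝ᵥ φ).re ≤
      (star ψ ⬝ᵥ (O *ᵥ ψ)).re * (star φ ⬝ᵥ φ).re := mul_le_mul_of_nonneg_right hψ hnφ
  rw [← key] at h1
  have h2 : (P * O).trace.re / (Module.finrank ℂ W : ℝ) * (star φ ⬝ᵥ φ).re ≤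
      (star φ ⬝ᵥ (O *ᵥ φ)).re :=
    le_of_mul_le_mul_right (by linarith [h1]) hψpos
  exact (mul_le_mul_of_nonneg_right ha hnφ).trans h2

end Abstract

/-! ### The sector ground eigenspace as the `β → ∞` target of the sector Gibbs state -/

section SectorGibbs

variable {n : Type*} [Fintype n] [DecidableEq n]

/-- **An eventual thermal bound gives SOME ground state.** `H` Hermitian, `K` an `H`-invariant
sector with ground eigenspace `V = K ⊓ ker (H - e₀) ≠ ⊥`: if `a ≤ re (tr (P_K e^{-βH} O) /
tr (P_K e^{-βH}))` for all large `β`, some nonzero `φ ∈ V` has `a‖φ‖² ≤ re⟨φ, Oφ⟩`. [this work] -/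
theorem exists_groundState_order_of_eventually_sectorGibbs {H : Matrix n n ℂ} (hH : H.IsHermitian)
    (K : Submodule ℂ (n → ℂ)) (hinv : ∀ v ∈ K, H *ᵥ v ∈ K)
    (hE₀ : K ⊓ Module.End.eigenspace (Matrix.toLin' H) ((H.minEnergyOn K : ℝ) : ℂ) ≠ ⊥)
    (O : Matrix n n ℂ) (a : ℝ)
    (h : ∀ᶠ β : ℝ in atTop, a ≤
      ((projMatrix (K.map ((WithLp.linearEquiv 2 ℂ (n → ℂ)).symm :
            (n → ℂ) →ₗ[ℂ] EuclideanSpace ℂ n)) * gibbsWeight β H * O).trace /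
        (projMatrix (K.map ((WithLp.linearEquiv 2 ℂ (n → ℂ)).symm :
            (n → ℂ) →ₗ[ℂ] EuclideanSpace ℂ n)) * gibbsWeight β H).trace).re) :
    ∃ φ ∈ K ⊓ Module.End.eigenspace (Matrix.toLin' H) ((H.minEnergyOn K : ℝ) : ℂ), φ ≠ 0 ∧
      a * (star φ ⬝ᵥ φ).re ≤ (star φ ⬝ᵥ (O *ᵥ φ)).re := by
  set V : Submodule ℂ (n → ℂ) := K ⊓ Module.End.eigenspace (Matrix.toLin' H)
    ((H.minEnergyOn K : ℝ) : ℂ) with hV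
  set P := projMatrix (V.map ((WithLp.linearEquiv 2 ℂ (n → ℂ)).symm :
    (n → ℂ) →ₗ[ℂ] EuclideanSpace ℂ n)) with hP
  have hav := mul_re_trace_le_of_eventually_sectorGibbsAverage hH K hinv hE₀ O a h
  rw [← hV, ← hP, trace_projMatrix_map_eq_finrank, Complex.natCast_re] at hav
  have hfr : (0 : ℝ) < (Module.finrank ℂ V : ℝ) :=
    Nat.cast_pos.mpr (Submodule.one_le_finrank_iff.mpr hE₀)
  obtain ⟨φ, hφV, hφ0, hφ⟩ := exists_mem_average_le_rayleigh (projMatrix_isHermitian _)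
    (fun w hw => projMatrix_map_mulVec_of_mem V hw) (projMatrix_map_mulVec_mem V) O hE₀
  refine ⟨φ, hφV, hφ0, le_trans (mul_le_mul_of_nonneg_right ((le_div_iff₀ hfr).2 hav)
    (Complex.nonneg_iff.mp (dotProduct_star_self_nonneg φ)).1) ?_⟩
  rw [hP]
  exact hφ

/-- **An eventual thermal bound + rigidity on the ground multiplet gives EVERY ground state**
(rigidity = constant Rayleigh quotient of `O` on `V ∖ 0`, homogeneous form). [this work] -/
theorem groundState_order_of_eventually_sectorGibbs_of_rigid {H : Matrix n n ℂ}
    (hH : H.IsHermitian) (K : Submodule ℂ (n → ℂ)) (hinv : ∀ v ∈ K, H *ᵥ v ∈ K)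
    (hE₀ : K ⊓ Module.End.eigenspace (Matrix.toLin' H) ((H.minEnergyOn K : ℝ) : ℂ) ≠ ⊥)
    (O : Matrix n n ℂ) (a : ℝ)
    (h : ∀ᶠ β : ℝ in atTop, a ≤
      ((projMatrix (K.map ((WithLp.linearEquiv 2 ℂ (n → ℂ)).symm :
            (n → ℂ) →ₗ[ℂ] EuclideanSpace ℂ n)) * gibbsWeight β H * O).trace /
        (projMatrix (K.map ((WithLp.linearEquiv 2 ℂ (n → ℂ)).symm :
            (n → ℂ) →ₗ[ℂ] EuclideanSpace ℂ n)) * gibbsWeight β H).trace).re)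
    (hrig : ∀ φ ∈ K ⊓ Module.End.eigenspace (Matrix.toLin' H) ((H.minEnergyOn K : ℝ) : ℂ),
      ∀ ψ ∈ K ⊓ Module.End.eigenspace (Matrix.toLin' H) ((H.minEnergyOn K : ℝ) : ℂ),
        (star φ ⬝ᵥ (O *ᵥ φ)).re * (star ψ ⬝ᵥ ψ).re =
          (star ψ ⬝ᵥ (O *ᵥ ψ)).re * (star φ ⬝ᵥ φ).re) :
    ∀ φ ∈ K ⊓ Module.End.eigenspace (Matrix.toLin' H) ((H.minEnergyOn K : ℝ) : ℂ),
      a * (star φ ⬝ᵥ φ).re ≤ (star φ ⬝ᵥ (O *ᵥ φ)).re := by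
  set V : Submodule ℂ (n → ℂ) := K ⊓ Module.End.eigenspace (Matrix.toLin' H)
    ((H.minEnergyOn K : ℝ) : ℂ) with hV
  set P := projMatrix (V.map ((WithLp.linearEquiv 2 ℂ (n → ℂ)).symm :
    (n → ℂ) →ₗ[ℂ] EuclideanSpace ℂ n)) with hP
  have hav := mul_re_trace_le_of_eventually_sectorGibbsAverage hH K hinv hE₀ O a h
  rw [← hV, ← hP, trace_projMatrix_map_eq_finrank, Complex.natCast_re] at hav
  exact rayleigh_ge_of_average_of_rigid (projMatrix_isHermitian _)
    (fun w hw => projMatrix_map_mulVec_of_mem V hw) (projMatrix_map_mulVec_mem V) O a hE₀ hrig hav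

/-- **The thermal formulation is necessary.** A bound `a‖φ‖² ≤ re⟨φ, Oφ⟩` on the whole ground
eigenspace `V ≠ ⊥` of the invariant sector `K` makes the sector Gibbs average of `O` eventually
(in `β`) `≥ a'` for every `a' < a`. [this work] -/
theorem eventually_sectorGibbs_of_groundState_order {H : Matrix n n ℂ} (hH : H.IsHermitian)
    (K : Submodule ℂ (n → ℂ)) (hinv : ∀ v ∈ K, H *ᵥ v ∈ K)
    (hE₀ : K ⊓ Module.End.eigenspace (Matrix.toLin' H) ((H.minEnergyOn K : ℝ) : ℂ) ≠ ⊥)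
    (O : Matrix n n ℂ) {a a' : ℝ} (haa : a' < a)
    (h : ∀ φ ∈ K ⊓ Module.End.eigenspace (Matrix.toLin' H) ((H.minEnergyOn K : ℝ) : ℂ),
      a * (star φ ⬝ᵥ φ).re ≤ (star φ ⬝ᵥ (O *ᵥ φ)).re) :
    ∀ᶠ β : ℝ in atTop, a' ≤
      ((projMatrix (K.map ((WithLp.linearEquiv 2 ℂ (n → ℂ)).symm :
            (n → ℂ) →ₗ[ℂ] EuclideanSpace ℂ n)) * gibbsWeight β H * O).trace /
        (projMatrix (K.map ((WithLp.linearEquiv 2 ℂ (n → ℂ)).symm :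
            (n → ℂ) →ₗ[ℂ] EuclideanSpace ℂ n)) * gibbsWeight β H).trace).re := by
  set V : Submodule ℂ (n → ℂ) := K ⊓ Module.End.eigenspace (Matrix.toLin' H)
    ((H.minEnergyOn K : ℝ) : ℂ) with hV
  set P := projMatrix (V.map ((WithLp.linearEquiv 2 ℂ (n → ℂ)).symm :
    (n → ℂ) →ₗ[ℂ] EuclideanSpace ℂ n)) with hP
  have hlim := tendsto_sectorGibbsAverage_atTop hH K hinv hE₀ O
  rw [← hV, ← hP] at hlim
  have hre := (Complex.continuous_re.tendsto _).comp hlim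
  have hfr : (0 : ℝ) < (Module.finrank ℂ V : ℝ) :=
    Nat.cast_pos.mpr (Submodule.one_le_finrank_iff.mpr hE₀)
  have hav : a * (Module.finrank ℂ V : ℝ) ≤ (P * O).trace.re :=
    finrank_mul_le_re_trace_mul (projMatrix_isHermitian _)
      (fun w hw => projMatrix_map_mulVec_of_mem V hw) (projMatrix_map_mulVec_mem V) O a h
  have hlt : a' < ((P * O).trace / P.trace).re := by
    rw [hP, trace_projMatrix_map_eq_finrank, ← hP, Complex.div_natCast_re]
    exact lt_of_lt_of_le haa ((le_div_iff₀ hfr).2 hav)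
  exact hre.eventually_const_le hlt

end SectorGibbs

/-! ### The Hubbard torus: thermal d-wave order, rigidity, and the summit -/

/-- The doped sector has a ground state: its ground eigenspace is `≠ ⊥`. [folklore] -/
theorem groundEigenspace_ne_bot (t U : ℝ) {δ : ℝ} (hδ : 0 < δ) (L : ℕ) :
    szSector (Λ := FermionTorus 2 L) (2 * ⌊(1 - δ) * (L : ℝ) ^ 2 / 2⌋₊) 0 ⊓
        Module.End.eigenspace (Matrix.toLin' (hubbardTorus 2 L t U))
          (((hubbardTorus 2 L t U).minEnergyOn
            (szSector (Λ := FermionTorus 2 L) (2 * ⌊(1 - δ) * (L : ℝ) ^ 2 / 2⌋₊) 0) : ℝ) : ℂ) ≠ ⊥ := by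
  obtain ⟨ψ, -, hgs⟩ :=
    InfVolFermionState.exists_unit_isGroundStateInSector_rectN t U (n := 1 - δ) (by linarith) L
  have hgs' : IsGroundStateInSector (hubbardTorus 2 L t U) (2 * ⌊(1 - δ) * (L : ℝ) ^ 2 / 2⌋₊) 0 ψ := by
    simpa [ThermodynamicLimit.rectN] using hgs
  obtain ⟨hK, hne, heig⟩ := hgs'
  exact (Submodule.ne_bot_iff _).2 ⟨ψ, Submodule.mem_inf.2
    ⟨hK, Module.End.mem_eigenspace_iff.2 (by rw [Matrix.toLin'_apply]; exact heig)⟩, hne⟩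

/-- **Theorem 10 (sufficiency half).** If for some `U > 0`, `δ ∈ (0, 1/2)`, `c > 0`, `L₀`, at
every even side `L = n+1 ≥ L₀` (with `H = hubbardTorus 2 L 1 U`, doped sector
`K = szSector (2⌊(1-δ)L²/2⌋) 0`, `O = Δ_d†Δ_d`): (i) THERMAL — `c L⁴ ≤ re (tr (P_K e^{-βH} O) /
tr (P_K e^{-βH}))` for all large `β` (depending on `L`); (ii) RIGIDITY — the Rayleigh quotient of
`O` is constant on the sector ground states (homogeneous form); then `HubbardSuperconductivity`.
Without (ii) only SOME ground state obeys the bound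
(`exists_groundState_order_of_eventually_sectorGibbs`). [this work] -/
theorem hubbardSuperconductivity_of_eventually_thermal_of_rigid
    (h : ∃ U : ℝ, 0 < U ∧ ∃ δ ∈ Set.Ioo (0 : ℝ) (1 / 2), ∃ c : ℝ, 0 < c ∧ ∃ L₀ : ℕ,
      ∀ n : ℕ, Even (n + 1) → L₀ ≤ n + 1 →
        (∀ᶠ β : ℝ in atTop, c * ((n + 1 : ℕ) : ℝ) ^ 4 ≤
          ((projMatrix ((szSector (Λ := FermionTorus 2 (n + 1))
                (2 * ⌊(1 - δ) * ((n + 1 : ℕ) : ℝ) ^ 2 / 2⌋₊) 0).map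
                ((WithLp.linearEquiv 2 ℂ (Fock (Orb (FermionTorus 2 (n + 1))))).symm :
                  Fock (Orb (FermionTorus 2 (n + 1))) →ₗ[ℂ]
                    EuclideanSpace ℂ (Finset (Orb (FermionTorus 2 (n + 1)))))) *
              gibbsWeight β (hubbardTorus 2 (n + 1) 1 U) *
              ((pairField dWaveFormFactor (n + 1))ᴴ * pairField dWaveFormFactor (n + 1))).trace /
            (projMatrix ((szSector (Λ := FermionTorus 2 (n + 1))
                (2 * ⌊(1 - δ) * ((n + 1 : ℕ) : ℝ) ^ 2 / 2⌋₊) 0).map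
                ((WithLp.linearEquiv 2 ℂ (Fock (Orb (FermionTorus 2 (n + 1))))).symm :
                  Fock (Orb (FermionTorus 2 (n + 1))) →ₗ[ℂ]
                    EuclideanSpace ℂ (Finset (Orb (FermionTorus 2 (n + 1)))))) *
              gibbsWeight β (hubbardTorus 2 (n + 1) 1 U)).trace).re) ∧
        (∀ φ ψ : Fock (Orb (FermionTorus 2 (n + 1))),
          IsGroundStateInSector (hubbardTorus 2 (n + 1) 1 U)
              (2 * ⌊(1 - δ) * ((n + 1 : ℕ) : ℝ) ^ 2 / 2⌋₊) 0 φ →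
          IsGroundStateInSector (hubbardTorus 2 (n + 1) 1 U)
              (2 * ⌊(1 - δ) * ((n + 1 : ℕ) : ℝ) ^ 2 / 2⌋₊) 0 ψ →
            (expect ((pairField dWaveFormFactor (n + 1))ᴴ * pairField dWaveFormFactor (n + 1)) φ).re
                * (star ψ ⬝ᵥ ψ).re =
              (expect ((pairField dWaveFormFactor (n + 1))ᴴ * pairField dWaveFormFactor (n + 1)) ψ).re
                * (star φ ⬝ᵥ φ).re)) :
    HubbardSuperconductivity := by
  obtain ⟨U, hU, δ, hδ, c, hc, L₀, hb⟩ := h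
  refine hubbardSuperconductivity_of_uniform_dWave_bound
    ⟨U, hU, δ, hδ, c, hc, L₀, fun n hn hL φ hφ1 hgs => ?_⟩
  obtain ⟨hth, hrig⟩ := hb n hn hL
  set H := hubbardTorus 2 (n + 1) 1 U
  set N : ℕ := 2 * ⌊(1 - δ) * ((n + 1 : ℕ) : ℝ) ^ 2 / 2⌋₊
  set O := (pairField dWaveFormFactor (n + 1))ᴴ * pairField dWaveFormFactor (n + 1)
  have hE₀ := groundEigenspace_ne_bot 1 U hδ.1 (n + 1)
  have key := groundState_order_of_eventually_sectorGibbs_of_rigid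
    (isHermitian_hubbardTorus (n + 1) 1 U) (szSector (Λ := FermionTorus 2 (n + 1)) N 0)
    (fun v hv => hubbardTorus_mulVec_mem_szSector 1 U hv) hE₀ O (c * ((n + 1 : ℕ) : ℝ) ^ 4) hth ?_
  · have hφ := key φ (Submodule.mem_inf.2
      ⟨hgs.1, Module.End.mem_eigenspace_iff.2 (by rw [Matrix.toLin'_apply]; exact hgs.2.2)⟩)
    rw [hφ1, Complex.one_re, mul_one] at hφ
    exact hφ
  · -- ground states of the sector = nonzero vectors of `K ⊓ ker (H - e₀)`
    have hgs_of : ∀ φ' ∈ szSector (Λ := FermionTorus 2 (n + 1)) N 0 ⊓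
        Module.End.eigenspace (Matrix.toLin' H) (((H.minEnergyOn (szSector N 0)) : ℝ) : ℂ),
        φ' ≠ 0 → IsGroundStateInSector H N 0 φ' := fun φ' hφ' hφ0 =>
      ⟨(Submodule.mem_inf.1 hφ').1, hφ0, by
        have h := Module.End.mem_eigenspace_iff.1 (Submodule.mem_inf.1 hφ').2
        rwa [Matrix.toLin'_apply] at h⟩
    intro φ' hφ' ψ' hψ'
    by_cases hφ0 : φ' = 0
    · subst hφ0; simp
    by_cases hψ0 : ψ' = 0
    · subst hψ0; simp
    exact hrig φ' ψ' (hgs_of φ' hφ' hφ0) (hgs_of ψ' hψ' hψ0)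

/-- **Theorem 10 (necessity half).** `HubbardSuperconductivity` ⟹ at every large even side the
canonical Gibbs state of the doped sector has `re (tr (P_K e^{-βH} Δ_d†Δ_d) / tr (P_K e^{-βH})) ≥
(c/2) L⁴` for all large `β` (how large depends on `L`: the summit's order of limits). [this work] -/
theorem eventually_thermal_of_hubbardSuperconductivity (hS : HubbardSuperconductivity) :
    ∃ U : ℝ, 0 < U ∧ ∃ δ ∈ Set.Ioo (0 : ℝ) (1 / 2), ∃ c : ℝ, 0 < c ∧ ∃ L₀ : ℕ,
      ∀ n : ℕ, Even (n + 1) → L₀ ≤ n + 1 →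
        ∀ᶠ β : ℝ in atTop, c / 2 * ((n + 1 : ℕ) : ℝ) ^ 4 ≤
          ((projMatrix ((szSector (Λ := FermionTorus 2 (n + 1))
                (2 * ⌊(1 - δ) * ((n + 1 : ℕ) : ℝ) ^ 2 / 2⌋₊) 0).map
                ((WithLp.linearEquiv 2 ℂ (Fock (Orb (FermionTorus 2 (n + 1))))).symm :
                  Fock (Orb (FermionTorus 2 (n + 1))) →ₗ[ℂ]
                    EuclideanSpace ℂ (Finset (Orb (FermionTorus 2 (n + 1)))))) *
              gibbsWeight β (hubbardTorus 2 (n + 1) 1 U) *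
              ((pairField dWaveFormFactor (n + 1))ᴴ * pairField dWaveFormFactor (n + 1))).trace /
            (projMatrix ((szSector (Λ := FermionTorus 2 (n + 1))
                (2 * ⌊(1 - δ) * ((n + 1 : ℕ) : ℝ) ^ 2 / 2⌋₊) 0).map
                ((WithLp.linearEquiv 2 ℂ (Fock (Orb (FermionTorus 2 (n + 1))))).symm :
                  Fock (Orb (FermionTorus 2 (n + 1))) →ₗ[ℂ]
                    EuclideanSpace ℂ (Finset (Orb (FermionTorus 2 (n + 1)))))) *
              gibbsWeight β (hubbardTorus 2 (n + 1) 1 U)).trace).re := by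
  obtain ⟨U, hU, δ, hδ, c, hc, L₀, hb⟩ := uniform_dWave_bound_of_hubbardSuperconductivity hS
  refine ⟨U, hU, δ, hδ, c, hc, L₀, fun n hn hL => ?_⟩
  set H := hubbardTorus 2 (n + 1) 1 U
  set N : ℕ := 2 * ⌊(1 - δ) * ((n + 1 : ℕ) : ℝ) ^ 2 / 2⌋₊
  set O := (pairField dWaveFormFactor (n + 1))ᴴ * pairField dWaveFormFactor (n + 1)
  have hE₀ := groundEigenspace_ne_bot 1 U hδ.1 (n + 1)
  have hpos : 0 < c * ((n + 1 : ℕ) : ℝ) ^ 4 := by positivity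
  refine eventually_sectorGibbs_of_groundState_order (isHermitian_hubbardTorus (n + 1) 1 U)
    (szSector (Λ := FermionTorus 2 (n + 1)) N 0)
    (fun v hv => hubbardTorus_mulVec_mem_szSector 1 U hv)
    hE₀ O (a := c * ((n + 1 : ℕ) : ℝ) ^ 4) (by linarith) fun φ hφ => ?_
  by_cases hφ0 : φ = 0
  · subst hφ0; simp
  -- normalise `φ` and use the every-ground-state bound at the unit vector `k • φ`
  obtain ⟨hmem, heig'⟩ := Submodule.mem_inf.1 hφ
  have heig : H *ᵥ φ = (((H.minEnergyOn (szSector N 0)) : ℝ) : ℂ) • φ := by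
    have h := Module.End.mem_eigenspace_iff.1 heig'
    rwa [Matrix.toLin'_apply] at h
  obtain ⟨k, hk0, hk1⟩ := Literature.MathematicalPhysics.QuantumLattice.exists_smul_unit hφ0
  have hb' := hb n hn hL (k • φ) hk1
    ⟨Submodule.smul_mem _ _ hmem, smul_ne_zero hk0 hφ0, by rw [mulVec_smul, heig, smul_comm]⟩
  have hkk : star k * k = ((‖k‖ ^ 2 : ℝ) : ℂ) := by
    rw [Complex.star_def, Complex.conj_mul']; push_cast; rfl
  rw [expect, mulVec_smul, star_smul, smul_dotProduct, dotProduct_smul, smul_smul, hkk, smul_eq_mul,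
    Complex.re_ofReal_mul] at hb'
  rw [star_smul, smul_dotProduct, dotProduct_smul, smul_smul, hkk, smul_eq_mul] at hk1
  have h1 : ‖k‖ ^ 2 * (star φ ⬝ᵥ φ).re = 1 := by
    have := congrArg Complex.re hk1
    rwa [Complex.re_ofReal_mul, Complex.one_re] at this
  have hkpos : 0 < ‖k‖ ^ 2 := pow_pos (norm_pos_iff.2 hk0) 2
  refine le_of_mul_le_mul_left ?_ hkpos
  calc ‖k‖ ^ 2 * (c * ((n + 1 : ℕ) : ℝ) ^ 4 * (star φ ⬝ᵥ φ).re)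
        = c * ((n + 1 : ℕ) : ℝ) ^ 4 * (‖k‖ ^ 2 * (star φ ⬝ᵥ φ).re) := by ring
    _ = c * ((n + 1 : ℕ) : ℝ) ^ 4 := by rw [h1, mul_one]
    _ ≤ _ := hb'

end Summit.HubbardSuperconductivity.HubbardSuperconductivity.Theorems
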